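import Summits.NavierStokesRegularity.NavierStokesRegularity.Theses.ComplexTouchdown
import HarnessLib.Audit

/-!
# Birth skeleton (BC3) of the crux `ComplexTouchdown.TouchdownDichotomy`

Crux item `stmt-NavierStokesRegularity-13849` (rank 2, the load-bearing bet of route
`route-NavierStokesRegularity-ComplexTouchdown`; decl
`Summit.NavierStokesRegularity.NavierStokesRegularity.Theses.ComplexTouchdown.TouchdownDichotomy`,
the 2026-08-15 σ-symmetric repair of stmt-1556). Tree path of this file:
`Summits/NavierStokesRegularity/NavierStokesRegularity/Cruxes/TouchdownDichotomy/Lines/birth.lean`.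
Registrar: `planner-skel-stmt-NavierStokesRegularity-13849-0`, 2026-08-17 (route re-audit bin
REPAIRABLE: the route predates the Lean birth certificate; this file supplies BC3 retroactively).
No `Disproof.lean`, no `Negative/` lemma, no idea card and no other workfile existed on the crux at
registration (`ledger crux ls stmt-NavierStokesRegularity-13849`: no workfiles).

## The crux (Z, "completeness / tameness of the touchdown")

With `ι = complexify : ℝ³ → ℂ³`: for every finite-energy classical solution `(u, p)` of unforced
NS (viscosity `ν > 0`) on `ℝ³ × [0,T)`, Leray–Hopf from a rapidly decaying datum, and every
`L∞`-singular point `x₀` at time `T` (`SingularAt`: `u` unbounded on every backward neighbourhood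
of `(x₀, T)`), the holomorphic continuation of `x ↦ u(t,x)` near `x₀` is, for `t ↑ T`, EITHER a
conjugate SHEET pair (`SheetAt`: tempered poles of order `α ≥ 2` along a uniformly
non-characteristic bounded-geometry hypersurface `Φ_t = 0` at height `h(t) → 0` and its mirror,
pair-of-poles upper bound on the `t`-uniform collar, pole lower bound on the scale-aware collar)
OR SCALE-FREE (`ScaleFreeAt`: a one-scale zoom `ε(t) F_t(ι ξ(t) + ε(t)·)`, `ξ(t) → x₀`,
`ε(t) → 0⁺`, converging locally uniformly on a complex tube to a limit `G` with non-constant real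
trace). `SheetAt` / `ScaleFreeAt` below are the two disjuncts of the route decl VERBATIM (only the
notations `ℝ³`, `ℂ³` abbreviate `EuclideanSpace ℝ/ℂ (Fin 3)`), so that `TouchdownDichotomy`
unfolds to `∀ ι, (∀ x, ι x = complexify x) → ∀ ν T u p, <Standing> → ∀ x₀, SingularAt T u x₀ →
SheetAt ι T u x₀ ∨ ScaleFreeAt ι T u x₀` by `rfl`.

## The cut — regime decomposition by the LOCAL BLOW-UP RATE at the touchdown point

The route's own case analysis of a touchdown runs on one parameter, the rate: in the SCALE-FREE
branch `-ε ε̇/ν → a` with `a = ∞` (sub-Leray, to be impossible), `a ∈ (0,∞)` (parabolic =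
Type I; Leray profile, Chae 2007), `a = 0` (Type II; locally steady, Landau-like); in the SHEET
branch the height `h(t)` against the amplitude `m(t)`. The rate is also where the available
TECHNOLOGY divides: under a Type-I bound the parabolic zooms are precompact and their limits are
Type-I ancient (mild, bounded, uniformly space-analytic) solutions which stay SINGULAR at the
origin by scale-invariant ε-regularity — so every zoom limit has NON-CONSTANT real trace for free
and the only obstruction to SCALE-FREE is NON-CONVERGENCE of the zoom (backward discretely
self-similar / oscillating touchdowns: exactly the declared gap of the crux); without a Type-I
bound the `L∞`-normalised (KNSS) zoom may converge to a CONSTANT (a velocity plateau), the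
Liouville theory is void, and anisotropic (sheet-like) collapse and steady Landau-type profiles
are the expected inhabitants. The skeleton therefore cuts Z into three named obligations:

* `stub_lerayFloor` [L/XL in Lean; KNOWN IN KIND — regime `a = ∞` is empty, made quantitative and
  local]: at an `L∞`-singular point the local supremum obeys LERAY'S RATE FROM BELOW at EVERY late
  time: for every `r₁ > 0` there are `c₁, τ₁ > 0` with `sup_{B(x₀,r₁)} ‖u(t,·)‖ ≥ c₁ √(ν/(T-t))`
  for all `t ∈ [T-τ₁, T)` (`LerayFloorAt`). Globally this is Leray 1934 §20 (in tree:
  `Literature.Analysis.FluidPDE.leray_blowup_rate_top`, proved); at a point it is the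
  CONCENTRATION phenomenon — Barker–Prange 2020 (arXiv:1812.09115 = doi:10.1007/s00205-020-01495-6)
  Thm 2: under a Type-I (Morrey) bound `‖u(t)‖_{L³(B(x₀, R√(T-t)))} > γ_univ` for all late `t`,
  hence the floor on parabolic balls; without Type I their Final discussion (p. 5) gives only
  `‖u(t)‖_{L³(B₁(x₀))} > γ_univ` for `t ∈ [t_*, T)`, and Maekawa–Miura–Prange give the rate at SOME
  centre `x(t)`; independent route: Kang–Miura–Tsai 2020 (doi:10.1093/imrn/rnz327) local-in-space
  short-time regularity. It is the time-UNIFORM lower envelope both branches of Z need (the SHEET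
  data `h, m` and the SCALE-FREE data `ξ, ε` are indexed by ALL `t ∈ [T-τ, T)`, not by a sequence).
  Why it might fail: only in the Type-II regime, by an "imported" singularity — a concentrating
  blob returning to `x₀` from distance `≥ r₁` infinitely often at diverging speed (no theorem
  excludes it; it would break both branches of Z as well, `ξ(t) ↛ x₀`).
* `stub_typeI_dichotomy` [XL, OPEN; regime `a ∈ (0,∞)`]: at a singular point with the floor and a
  LOCAL TYPE-I BOUND `‖u(t,x)‖ ≤ C √(ν/(T-t))` on a backward parabolic neighbourhood (`TypeIAt`),
  the touchdown is SHEET or SCALE-FREE. Owned by Type-I compactness (Koch–Nadirashvili–Seregin–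
  Šverák 2009, Seregin–Šverák 2009: parabolic zooms → bounded mild ancient solutions, uniformly
  analytic in a strip by Guberović 2010 = `guberovic2010_analyticity_radius`, proved in tree), by
  ε-regularity (`ckn_epsilon_regularity_holds`) which keeps every zoom limit singular hence
  non-constant, and by the DSS theory (Chae–Wolf 2017 `chae_wolf_dss_existence`, Tsai, Bradshaw–
  Tsai). Content: CONVERGENCE of the parabolic zoom (uniqueness of the tangent flow) or a sheet.
  Why it might fail: a backward discretely self-similar Type-I blow-up from rapidly decaying data
  (λ-DSS, `λ` large: Chae–Wolf Thm 1.3 removes only `λ ∈ (1, λ*)`) is in neither branch — the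
  crux's declared gap, now isolated in one regime.
* `stub_typeII_dichotomy` [XL, OPEN; regime `a = 0`]: at a singular point with the floor where the
  local Type-I bound FAILS for every constant, radius and time window (`TypeIIAt`, the negation of
  `TypeIAt` stated positively), the touchdown is SHEET or SCALE-FREE. Owned by the `L∞`-normalised
  zoom (Koch–Nadirashvili–Seregin–Šverák 2009, arXiv:0709.3599: rescaling at near-maxima yields
  bounded ancient mild solutions — here possibly CONSTANT), by the steady/Landau analysis of
  `a = 0` profiles (Šverák 2011 doi:10.1007/s10958-011-0590-5; Chae 2010 Thm 1.4;
  `LiouvilleConjectureNS`) and by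
  the complex-singularity calculus of the card (tangency / order `α ≥ 2` on non-characteristic
  sheets, PaulsEtAl2006 p. 4; Li–Sinai 2008 complex blow-ups as the model inhabitants of SHEET).
  Why it might fail: multi-scale Type-II cascades (Tao's averaged blow-up morphology), collapsing
  or clustered sheets, log-branching — the remaining declared gaps of the crux.

`TouchdownDichotomy_of : TouchdownDichotomy` (the ONLY theorem of this file whose conclusion is the
crux, BY NAME; no `Prop` hypotheses; `sorry` only inside the three `stub_*`, each used by name) is
the real composition: bundle the standing hypotheses, take the floor from `stub_lerayFloor`, and
split on `TypeIAt ν T u x₀` by excluded middle — the positive case is `stub_typeI_dichotomy`, the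
negative case is converted to `TypeIIAt` (`typeIIAt_of_not_typeIAt`: `by_contra` + `push Not`) and handed to
`stub_typeII_dichotomy`; the disjunction `SheetAt ∨ ScaleFreeAt` closes the goal definitionally.

## BC3 probes (registrar folder `bc/probe_<stub>_<target>.lean`, farm `lean check`, 2026-08-17)

For each stub `S ∈ {lerayFloor, typeI_dichotomy, typeII_dichotomy}` and each target
`C = TouchdownDichotomy`, `S = NavierStokesRegularity`: `set_option maxHeartbeats 400000 in
theorem probe : <sig S> → <target> := by first | exact? | (intro h; simpa using h) |
simpa [<vocabulary>] | (intro h; simpa [<vocabulary>, <target>] using h) | aesop` in a file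
containing ONLY the vocabulary below (no stub, no composition) — all 6 FAIL: rc 1, `unsolved goals
⊢ TouchdownDichotomy` / `⊢ NavierStokesRegularity` after the whole battery, last alternative
`aesop: failed to prove the goal after exhaustive search` (walls 43/19/43/19/42/21 s; raw outputs
in the registrar's NOTES.md `birth-certificate:`). No stub is cheaply the crux or the summit: the
floor concludes a rate inequality, not a classification; each regime stub carries a rate
hypothesis the crux does not supply.

## Rejected cuts (registrar's notes)

(i) "PDE → SCV interface lemma (local tube continuation with bounds) + classification": the tree's
local analyticity fact `bradshawGrujicKukavica2015_local_analyticity_radius` (proved) carries NO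
bound on the extension and the bounded global one (`guberovic2010_analyticity_radius`, proved) needs
an `L∞(ℝ³)` datum; a correctly quantified LOCAL bounded-tube lemma (far-field pressure as analytic
forcing, radius capped by the ball) is easy to misstate, and the remaining "classification" stub
would be the crux minus a known lemma (costume). (ii) "zoom converges ∨ zoom degenerates" at the
intrinsic scale `ν/‖u‖∞`: `SF ∨ ¬SF` in disguise, and the intrinsic zoom can converge to a constant
(plateau) without refuting Z. (iii) Isotropic-vs-anisotropic concentration of the real profile: the
faithful geometric cut, but it needs the singular locus `Σ_t` as an object (definition request
`HasHolomorphicTubeExtension` foreseen in the route header) — layer 2, not a birth skeleton.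

## Disproof used

None exists (`disproof_path` absent from the payload; no `_false_without_` theorem, no Negative
lemma, no dead line on this crux). The stub set honours the refuter's crux-attack findings on the
item (CruxAttack_13849.md, 2026-08-15): (F1) "Leray–Hopf + decay are load-bearing — an explicit
infinite-energy classical blow-up (log-rotating linear strain) is in NEITHER branch": every stub
keeps the full standing hypotheses (`Standing` bundles `IsLerayHopfOn` and `HasRapidSpatialDecay`);
(F2) "the statement is implied by NoTouchdown / Clay A": so is every stub (each has `SingularAt`
among its hypotheses or, for the floor, is vacuous at regular points) — the stubs are consequences
of the summit exactly as the crux is, and are used TOWARD it here.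
-/

noncomputable section

open scoped BigOperators Topology
open Filter Set

namespace Summit.NavierStokesRegularity.NavierStokesRegularity.Cruxes.TouchdownDichotomy.Birth

open Literature.Analysis.FluidPDE
open Literature.Analysis.FunctionSpaces.EuclideanSpace (complexify)
open Summit.NavierStokesRegularity.NavierStokesRegularity.Theses.ComplexTouchdown (TouchdownDichotomy)

set_option linter.unusedVariables false
set_option linter.dupNamespace false

local notation "ℝ³" => EuclideanSpace ℝ (Fin 3)
local notation "ℂ³" => EuclideanSpace ℂ (Fin 3)

/-! ## Vocabulary (transparent abbreviations of the crux's own sub-formulas) -/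

/-- The standing hypotheses of every item of route `ComplexTouchdown`: `ν > 0`, `T > 0`, `(u, p)`
a classical solution of unforced NS with viscosity `ν` on `[0,T) × ℝ³`, Leray–Hopf on `[0,T)` from
its own initial slice, `u 0` rapidly decaying. -/
def Standing (ν T : ℝ) (u : ℝ → ℝ³ → ℝ³) (p : ℝ → ℝ³ → ℝ) : Prop :=
  0 < ν ∧ 0 < T ∧ IsClassicalNSSolutionOn (Set.Ico 0 T) ν 0 u p ∧ IsLerayHopfOn T ν 0 (u 0) u ∧
    HasRapidSpatialDecay (u 0)

/-- **`x₀` is an `L∞`-singular (touchdown) point at time `T`** — the antecedent of the crux,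
verbatim: `u` is unbounded on every backward neighbourhood `{T - r < t < T, |x - x₀| < r}`. -/
def SingularAt (T : ℝ) (u : ℝ → ℝ³ → ℝ³) (x₀ : ℝ³) : Prop :=
  ∀ r > (0:ℝ), ∀ M : ℝ, ∃ t ∈ Set.Ico (0:ℝ) T, T - r < t ∧ ∃ x : ℝ³, dist x x₀ < r ∧ M < ‖u t x‖

/-- **Local Type-I bound at `(x₀, T)`**: on some backward neighbourhood
`[T - τ₁, T) × B(x₀, r₁)` the velocity obeys Leray's self-similar rate from ABOVE,
`‖u(t,x)‖ ≤ C √(ν/(T - t))`. (Trivially true near a regular point; at a singular point it is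
Type-I blow-up with constant `C`.) -/
def TypeIAt (ν T : ℝ) (u : ℝ → ℝ³ → ℝ³) (x₀ : ℝ³) : Prop :=
  ∃ C r₁ τ₁ : ℝ, 0 < r₁ ∧ 0 < τ₁ ∧
    ∀ t ∈ Set.Ico (T - τ₁) T, ∀ x : ℝ³, dist x x₀ < r₁ → ‖u t x‖ ≤ C * Real.sqrt (ν / (T - t))

/-- **Locally Type II at `(x₀, T)`** — the negation of `TypeIAt`, stated positively: for every
constant, radius and time window the Type-I bound is violated somewhere in the window. -/
def TypeIIAt (ν T : ℝ) (u : ℝ → ℝ³ → ℝ³) (x₀ : ℝ³) : Prop :=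
  ∀ C r₁ τ₁ : ℝ, 0 < r₁ → 0 < τ₁ →
    ∃ t ∈ Set.Ico (T - τ₁) T, ∃ x : ℝ³, dist x x₀ < r₁ ∧ C * Real.sqrt (ν / (T - t)) < ‖u t x‖

/-- **Local Leray floor at `(x₀, T)`**: in every ball about `x₀` the supremum of `‖u(t,·)‖` obeys
Leray's rate from BELOW at every late time — for every `r₁ > 0` there are `c₁, τ₁ > 0` (`τ₁ ≤ T`)
with `∃ x ∈ B(x₀, r₁), c₁ √(ν/(T - t)) ≤ ‖u(t,x)‖` for all `t ∈ [T - τ₁, T)`. -/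
def LerayFloorAt (ν T : ℝ) (u : ℝ → ℝ³ → ℝ³) (x₀ : ℝ³) : Prop :=
  ∀ r₁ > (0:ℝ), ∃ c₁ τ₁ : ℝ, 0 < c₁ ∧ 0 < τ₁ ∧ τ₁ ≤ T ∧
    ∀ t ∈ Set.Ico (T - τ₁) T, ∃ x : ℝ³, dist x x₀ < r₁ ∧ c₁ * Real.sqrt (ν / (T - t)) ≤ ‖u t x‖

/-- **SHEET (conjugate pair) touchdown at `x₀`** — the first disjunct of `TouchdownDichotomy`,
verbatim (σ-symmetric typing of the 2026-08-15 repair): `t`-uniform `r, c > 0`, `K`, `B`, order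
`α ≥ 2`, `τ > 0`, heights `h(t) → 0`, amplitudes `m(t) > 0`, a holomorphic bounded uniformly
non-characteristic defining function `Φ_t` on `B(ι x₀, r)`, zero-free on the two-sided tube `D_t`
of half-width `h(t)` with a roof zero above a point within `r/2` of `x₀`, and the continuation
`F_t` of `u(t)` on `D_t` with the pair-of-poles upper bound on the collar
`{min(|Φ_t(z)|, |Φ_t(σz)|) < c}` and the pole lower bound on `{|Φ_t| < c h(t)}`. -/
def SheetAt (ι : ℝ³ → ℂ³) (T : ℝ) (u : ℝ → ℝ³ → ℝ³) (x₀ : ℝ³) : Prop :=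
  ∃ (r c K α τ B : ℝ) (Φ : ℝ → ℂ³ → ℂ) (h m : ℝ → ℝ) (F : ℝ → ℂ³ → ℂ³),
    0 < r ∧ 0 < c ∧ 2 ≤ α ∧ 0 < τ ∧ τ ≤ T ∧
    Filter.Tendsto h (nhdsWithin T (Set.Iio T)) (nhds 0) ∧
    ∀ t ∈ Set.Ico (T - τ) T, ∀ (D : Set ℂ³),
      D = (Metric.ball (ι x₀) r ∩
            {z : ℂ³ | ∃ x y : ℝ³, dist x x₀ < r ∧ ‖y‖ < h t ∧ z = ι x + Complex.I • ι y}) →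
      0 < h t ∧ 0 < m t ∧
      DifferentiableOn ℂ (Φ t) (Metric.ball (ι x₀) r) ∧
      (∀ z ∈ Metric.ball (ι x₀) r, ‖Φ t z‖ ≤ K) ∧
      (∀ z ∈ Metric.ball (ι x₀) r, Φ t z = 0 →
        c ≤ ‖∑ i : Fin 3, (fderiv ℂ (Φ t) z (EuclideanSpace.single i (1:ℂ))) ^ 2‖) ∧
      (∀ z ∈ D, Φ t z ≠ 0) ∧
      (∃ x y : ℝ³, dist x x₀ < r / 2 ∧ ‖y‖ = h t ∧ ι x + Complex.I • ι y ∈ Metric.ball (ι x₀) r ∧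
        Φ t (ι x + Complex.I • ι y) = 0) ∧
      DifferentiableOn ℂ (F t) D ∧
      (∀ x : ℝ³, dist x x₀ < r → F t (ι x) = ι (u t x)) ∧
      (∀ x y : ℝ³, ι x + Complex.I • ι y ∈ D →
        (‖Φ t (ι x + Complex.I • ι y)‖ < c ∨ ‖Φ t (ι x - Complex.I • ι y)‖ < c) →
        ‖F t (ι x + Complex.I • ι y)‖ ≤
          K * m t * (‖Φ t (ι x + Complex.I • ι y)‖ ^ (-α) + ‖Φ t (ι x - Complex.I • ι y)‖ ^ (-α))
            + B) ∧
      (∀ z ∈ D, ‖Φ t z‖ < c * h t → c * m t * ‖Φ t z‖ ^ (-α) - B ≤ ‖F t z‖)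

/-- **SCALE-FREE touchdown at `x₀`** — the second disjunct of `TouchdownDichotomy`, verbatim:
centres `ξ(t) → x₀`, one length `ε(t) → 0⁺`, `R > 1`, the continuation `F_t` of `u(t)` on the
tube of half-width `ε(t)` over `B(ξ(t), R ε(t))`, and locally uniform convergence of the zoom
`ε(t) F_t(ι ξ(t) + ε(t) w)` on the unit-height tube over `B_R` to a holomorphic `G` with
non-constant real trace `G ∘ ι`. -/
def ScaleFreeAt (ι : ℝ³ → ℂ³) (T : ℝ) (u : ℝ → ℝ³ → ℝ³) (x₀ : ℝ³) : Prop :=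
  ∃ (ξ : ℝ → ℝ³) (ε : ℝ → ℝ) (τ R : ℝ) (G : ℂ³ → ℂ³) (F : ℝ → ℂ³ → ℂ³),
    0 < τ ∧ τ ≤ T ∧ 1 < R ∧
    Filter.Tendsto ξ (nhdsWithin T (Set.Iio T)) (nhds x₀) ∧
    Filter.Tendsto ε (nhdsWithin T (Set.Iio T)) (nhds 0) ∧
    (∀ t ∈ Set.Ico (T - τ) T, 0 < ε t) ∧
    DifferentiableOn ℂ G
      {z : ℂ³ | ∃ x y : ℝ³, dist x (0:ℝ³) < R ∧ ‖y‖ < 1 ∧ z = ι x + Complex.I • ι y} ∧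
    (∃ x x' : ℝ³, dist x (0:ℝ³) < R ∧ dist x' (0:ℝ³) < R ∧ G (ι x) ≠ G (ι x')) ∧
    (∀ t ∈ Set.Ico (T - τ) T,
      DifferentiableOn ℂ (F t)
        {z : ℂ³ | ∃ x y : ℝ³, dist x (ξ t) < R * ε t ∧ ‖y‖ < ε t ∧ z = ι x + Complex.I • ι y} ∧
      ∀ x : ℝ³, dist x (ξ t) < R * ε t → F t (ι x) = ι (u t x)) ∧
    TendstoLocallyUniformlyOn (fun t w => ((ε t : ℝ) : ℂ) • F t (ι (ξ t) + ((ε t : ℝ) : ℂ) • w)) G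
      (nhdsWithin T (Set.Iio T))
      {z : ℂ³ | ∃ x y : ℝ³, dist x (0:ℝ³) < R ∧ ‖y‖ < 1 ∧ z = ι x + Complex.I • ι y}

/-- Sanity (definitional, an `example` so that nothing depends on it): the crux IS "standing
hypotheses ⇒ at a singular point, SHEET or SCALE-FREE" in this vocabulary. -/
example :
    TouchdownDichotomy ↔
      ∀ (ι : ℝ³ → ℂ³), (∀ x : ℝ³, ι x = complexify x) →
        ∀ (ν T : ℝ) (u : ℝ → ℝ³ → ℝ³) (p : ℝ → ℝ³ → ℝ),
          0 < ν → 0 < T → IsClassicalNSSolutionOn (Set.Ico 0 T) ν 0 u p →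
          IsLerayHopfOn T ν 0 (u 0) u → HasRapidSpatialDecay (u 0) →
          ∀ x₀ : ℝ³, SingularAt T u x₀ → SheetAt ι T u x₀ ∨ ScaleFreeAt ι T u x₀ :=
  Iff.rfl

/-! ## The stubs -/

/-- **Stub F — `stub_lerayFloor` (local Leray-rate floor at a touchdown point; KNOWN IN KIND,
L/XL in Lean).** At an `L∞`-singular point `x₀` of a standing solution, for every `r₁ > 0` there
are `c₁, τ₁ > 0` such that at EVERY time `t ∈ [T - τ₁, T)` some point of `B(x₀, r₁)` carries
`‖u(t,x)‖ ≥ c₁ √(ν/(T - t))`. Sources: Leray 1934 §20 (global: `leray_blowup_rate_top`, proved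
in tree); Barker–Prange 2020 arXiv:1812.09115 Thm 2 (parabolic `L³` concentration at a Type-I
singular point) and Final discussion p. 5 (`‖u(t)‖_{L³(B₁(x₀))} > γ_univ`, any singular point);
Maekawa–Miura–Prange 2017 (rate at some centre `x(t)`); Kang–Miura–Tsai 2020
doi:10.1093/imrn/rnz327 (local short-time regularity); Escauriaza–Seregin–Šverák 2003 / Seregin
2012 (`L³` blow-up). Mechanism: contrapositive — if the local sup dips below `c₁ √(ν/(T - t₀))`
at one late time, localized smoothing (local `L∞` data, far field entering only as an analytic
pressure forcing of size `≲ E₀/r₁³`) keeps `u` bounded on `B(x₀, r₁/2)` for a time `≳ ν c₁⁻²/(…)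
≥ T - t₀`, so `(x₀, T)` is regular. Why it might fail: a Type-II "imported" singularity returning
to `x₀` from distance `≥ r₁` infinitely often at diverging speed (excluded by no theorem; it breaks
both branches of the crux too). -/
theorem stub_lerayFloor :
    ∀ (ν T : ℝ) (u : ℝ → ℝ³ → ℝ³) (p : ℝ → ℝ³ → ℝ), Standing ν T u p →
      ∀ x₀ : ℝ³, SingularAt T u x₀ → LerayFloorAt ν T u x₀ := by
  sorry

/-- **Stub I — `stub_typeI_dichotomy` (the Type-I regime of the crux; OPEN, XL).** With
`ι = complexify`: at an `L∞`-singular point of a standing solution which has the local Leray floor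
and a LOCAL TYPE-I BOUND `‖u(t,x)‖ ≤ C √(ν/(T - t))` on a backward neighbourhood of `(x₀, T)`,
the touchdown is a conjugate SHEET pair or SCALE-FREE. Owned by Type-I compactness: parabolic
zooms are precompact with bounded mild ancient limits (Koch–Nadirashvili–Seregin–Šverák 2009,
Seregin–Šverák 2009), uniformly analytic in a strip (Guberović 2010 =
`guberovic2010_analyticity_radius`, proved in tree; BGK 2016 Thm 2.4.1), singular at the origin
by ε-regularity (`ckn_epsilon_regularity_holds`) hence with NON-CONSTANT real trace; what remains
is CONVERGENCE of the zoom as `t ↑ T` (uniqueness of the tangent flow) or else the sheet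
geometry. Leans on: `chae_wolf_dss_existence`, `chae2007_asymptoticallySelfSimilar_local`,
`necas_ruzicka_sverak_holds`, `tsai_selfsimilar_holds` (sinks for the limits). Why it might fail:
a backward λ-DSS Type-I blow-up from rapidly decaying data (Chae–Wolf 2017 arXiv:1610.09464
Thm 1.3 removes only `λ ∈ (1, λ*)`) oscillates between profiles — neither branch; this is the
crux's declared gap, isolated here in one regime. -/
theorem stub_typeI_dichotomy :
    ∀ (ι : ℝ³ → ℂ³), (∀ x : ℝ³, ι x = complexify x) →
      ∀ (ν T : ℝ) (u : ℝ → ℝ³ → ℝ³) (p : ℝ → ℝ³ → ℝ), Standing ν T u p →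
        ∀ x₀ : ℝ³, SingularAt T u x₀ → LerayFloorAt ν T u x₀ → TypeIAt ν T u x₀ →
          SheetAt ι T u x₀ ∨ ScaleFreeAt ι T u x₀ := by
  sorry

/-- **Stub II — `stub_typeII_dichotomy` (the Type-II regime of the crux; OPEN, XL).** With
`ι = complexify`: at an `L∞`-singular point of a standing solution which has the local Leray
floor and at which the local Type-I bound FAILS for every constant, radius and window
(`TypeIIAt`), the touchdown is a conjugate SHEET pair or SCALE-FREE. Owned by the `L∞`-normalised
zoom (Koch–Nadirashvili–Seregin–Šverák 2009, arXiv:0709.3599: rescaling at near-maxima yields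
bounded ancient mild solutions — here possibly CONSTANT, a velocity plateau, so non-constancy of
the real trace is the issue and anisotropic, sheet-like collapse is the expected alternative), by
the steady-profile analysis of the `a = 0` scale-free case (Landau solutions, Šverák 2011
doi:10.1007/s10958-011-0590-5; `LiouvilleConjectureNS`; Chae 2010 doi:10.1016/j.jfa.2010.02.006
Thm 1.4), and by the card's
complex-singularity calculus (tangency / order `α ≥ 2` on non-characteristic sheets,
PaulsEtAl2006 arXiv:nlin/0510059 p. 4; Li–Sinai 2008 complex blow-ups as model sheets;
Weiss–Tabor–Carnevale 1983, Kichenassamy 2007 for the Fuchsian/ψ-series side). Why it might fail: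
multi-scale Type-II cascades, collapsing (`κ → ∞`) or clustered sheets with unequal amplitudes,
characteristic sheets, log-branching, order `α < 2` — the remaining declared gaps of the crux. -/
theorem stub_typeII_dichotomy :
    ∀ (ι : ℝ³ → ℂ³), (∀ x : ℝ³, ι x = complexify x) →
      ∀ (ν T : ℝ) (u : ℝ → ℝ³ → ℝ³) (p : ℝ → ℝ³ → ℝ), Standing ν T u p →
        ∀ x₀ : ℝ³, SingularAt T u x₀ → LerayFloorAt ν T u x₀ → TypeIIAt ν T u x₀ →
          SheetAt ι T u x₀ ∨ ScaleFreeAt ι T u x₀ := by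
  sorry

/-! ## The composition (kernel-checked; `sorry` enters only through the three stubs) -/

/-- Excluded middle on the local rate, in the skeleton's vocabulary: a point that is not locally
Type I is locally Type II. [folklore] -/
theorem typeIIAt_of_not_typeIAt {ν T : ℝ} {u : ℝ → ℝ³ → ℝ³} {x₀ : ℝ³}
    (h : ¬ TypeIAt ν T u x₀) : TypeIIAt ν T u x₀ := by
  intro C r₁ τ₁ hr₁ hτ₁
  by_contra hcon
  push Not at hcon
  exact h ⟨C, r₁, τ₁, hr₁, hτ₁, fun t ht x hx => hcon t ht x hx⟩

/-- **Birth composition (the skeleton theorem).** The crux BY NAME from the three registered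
stubs, used by name: bundle the standing hypotheses, take the floor (`stub_lerayFloor`), split on
`TypeIAt ν T u x₀` — `stub_typeI_dichotomy` in the Type-I regime, `stub_typeII_dichotomy` (via
`typeIIAt_of_not_typeIAt`) otherwise; `SheetAt ∨ ScaleFreeAt` is the crux's disjunction
definitionally. -/
theorem TouchdownDichotomy_of : TouchdownDichotomy := by
  have hF := stub_lerayFloor
  have hI := stub_typeI_dichotomy
  have hII := stub_typeII_dichotomy
  intro ι hι ν T u p hν hT hcl hLH hdec x₀ hsing
  have hS : Standing ν T u p := ⟨hν, hT, hcl, hLH, hdec⟩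
  have hfl : LerayFloorAt ν T u x₀ := hF ν T u p hS x₀ hsing
  by_cases hTI : TypeIAt ν T u x₀
  · exact hI ι hι ν T u p hS x₀ hsing hfl hTI
  · exact hII ι hι ν T u p hS x₀ hsing hfl (typeIIAt_of_not_typeIAt hTI)

end Summit.NavierStokesRegularity.NavierStokesRegularity.Cruxes.TouchdownDichotomy.Birth

end
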